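import Literature.NumberTheory.LFunctions.FordIncompleteS3
import Literature.NumberTheory.LFunctions.FordIncompleteJt
import Mathlib.Data.ZMod.Basic
import HarnessLib

/-!
# Ford's Lemma 4.1, case `S₄`: the congruence count `𝓑(m)` via CRT and Wooley's theorem

Topic `Literature/NumberTheory/LFunctions`. Everything here is PROVED.

For `q` whose prime factors exceed `k`, heads `x ∈ ℬ^t` (`1 ≤ x_i ≤ P < q^h`) with
`(q, J*(x)) = 1`, and any targets `c`, the number of `x` with `∑_i x_i^j ≡ c_j (mod q^h)` for
`h ≤ j ≤ k` is at most `(k^t)^{ω(q)}`: reduce modulo each `p^{hℓ} ∥ q^h`, apply Wooley's theorem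
(Ford's Lemma 2.4) to the system of degrees `h, …, k` (non-singular Jacobian
`(k!/(h-1)!) (x_1⋯x_t)^{h-1} V(x)` modulo `p`), and multiply by the Chinese remainder theorem.

* `FordVK.card_cong_le` — the bound `(k^t)^{ω(q)}` (Ford: `𝓑'(n; q^r) ≤ ∏_{p^ℓ ∥ q} 𝓑'(n; p^{rℓ})`,
  `𝓑' ≤ k!/(h-1)! ≤ k^t`).

## References

* K. Ford, Proc. London Math. Soc. (3) 85 (2002), 565–633, proof of Lemma 4.1 (case S₄, the
  paragraph "Next, by Proposition ZRD …"). [Ford2002]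
-/

noncomputable section

open Finset MvPolynomial

namespace Literature.NumberTheory.LFunctions
namespace FordVK

open VMV FordSmooth

section Cong

variable {t h k : ℕ}

/-- `J*(x) = x_1⋯x_t · det V(x)`. [folklore] -/
theorem Jstar_eq_prod_mul_det (x : Fin t → ℤ) : Jstar x = (∏ i, x i) * (Matrix.vandermonde x).det := by
  rw [Jstar, Matrix.det_vandermonde]

/-- The non-vanishing of the Jacobian modulo a prime `p > k` not dividing `J*(x)`:
`p ∤ ∏_j (h+j) · V(x) · ∏_i x_i^{h-1}`. [cite: Ford2002, proof of Lemma 4.1 ("(q, J(x)) = 1" and (4.2))] -/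
theorem not_dvd_jac_formula {p : ℕ} (hp : p.Prime) (hpk : k < p) (hh : 1 ≤ h) (hk : h + t = k + 1)
    {x : Fin t → ℤ} (hcop : ¬ p ∣ JN x) :
    ¬ (p : ℤ) ∣ (∏ j : Fin t, ((h : ℤ) + j.val)) * (Matrix.vandermonde x).det
        * ∏ i, (1 : ℤ) * x i ^ (h - 1) := by
  have hpZ : Prime (p : ℤ) := Nat.prime_iff_prime_int.mp hp
  have hJ : ¬ (p : ℤ) ∣ Jstar x := fun hd => hcop (Int.natCast_dvd.1 hd)
  rw [Jstar_eq_prod_mul_det] at hJ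
  intro hd
  rcases hpZ.dvd_or_dvd hd with hd | hd
  · rcases hpZ.dvd_or_dvd hd with hd | hd
    · -- `p ∣ ∏ (h + j)`: impossible since `0 < h + j ≤ k < p`
      rw [hpZ.dvd_finsetProd_iff] at hd
      obtain ⟨j, -, hj⟩ := hd
      have h1 : (0 : ℤ) < (h : ℤ) + j.val := by positivity
      have h2 : (h : ℤ) + j.val < p := by
        have := j.2; have : h + j.val ≤ k := by omega
        exact_mod_cast lt_of_le_of_lt this hpk
      have := Int.le_of_dvd h1 hj
      linarith
    · exact hJ (dvd_mul_of_dvd_right hd _)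
  · rw [hpZ.dvd_finsetProd_iff] at hd
    obtain ⟨i, -, hi⟩ := hd
    rw [one_mul] at hi
    have hxi := hpZ.dvd_of_dvd_pow hi
    exact hJ (dvd_mul_of_dvd_left (hxi.trans (Finset.dvd_prod_of_mem x (mem_univ i))) _)

/-- The `ZMod p` image of `% N` for `p ∣ N`. [folklore] -/
theorem zmod_cast_emod_of_dvd {p N : ℕ} (hpN : p ∣ N) (a : ℤ) :
    ((a % (N : ℤ) : ℤ) : ZMod p) = (a : ZMod p) := by
  rw [ZMod.intCast_eq_intCast_iff_dvd_sub]
  have h1 : (N : ℤ) ∣ a - a % N := Int.dvd_self_sub_emod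
  exact (Int.natCast_dvd_natCast.2 hpN).trans h1

/-- **The congruence count** `#{x : ∑_i x_i^j ≡ c_j (mod q^h), h ≤ j ≤ k, (q, J*(x)) = 1} ≤ (k^t)^{ω(q)}`
for heads `x` with `1 ≤ x_i ≤ P < q^h` and `q` with all prime factors `> k`.
[cite: Ford2002, proof of Lemma 4.1 (case S₄: "𝓑'(n;q^r) ≤ ∏ 𝓑'(n;p^{rℓ}) … Lemma 2.4 gives
𝓑'(n;p^{rℓ}) ≤ k!/(h-1)! ≤ k^t")] -/
theorem card_cong_le (hh : 1 ≤ h) (hk : h + t = k + 1) {q : ℕ} (hq0 : q ≠ 0)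
    (hqk : ∀ p ∈ q.primeFactors, k < p) {P : ℝ} (hPq : P < (q : ℝ) ^ h)
    (S : Finset (Fin t → ℤ)) (hSB : ∀ x ∈ S, ∀ i, 1 ≤ x i ∧ (x i : ℝ) ≤ P)
    (hcop : ∀ x ∈ S, Nat.Coprime q (JN x)) (c : Fin k → ℤ)
    (hcong : ∀ x ∈ S, ∀ j : Fin k, h ≤ j.val + 1 → ((q : ℤ) ^ h) ∣ psv k x j - c j) :
    S.card ≤ (k ^ t) ^ q.primeFactors.card := by
  classical
  -- the moduli `N_p = p^{h ℓ_p}`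
  set ℓ : ℕ → ℕ := fun p => q.factorization p with hℓ
  set Np : ℕ → ℕ := fun p => p ^ (h * ℓ p) with hNp
  have hNp_pos : ∀ p ∈ q.primeFactors, 0 < Np p := fun p hp =>
    pow_pos (Nat.prime_of_mem_primeFactors hp).pos _
  have hNp_dvd : ∀ p ∈ q.primeFactors, (Np p : ℤ) ∣ (q : ℤ) ^ h := by
    intro p hp
    have : Np p ∣ q ^ h := by
      rw [hNp]; simp only
      rw [pow_mul', ]
      exact pow_dvd_pow_of_dvd (Nat.ordProj_dvd q p) h
    exact_mod_cast this
  have hprodNp : ∏ p ∈ q.primeFactors, Np p = q ^ h := by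
    simp only [hNp]
    rw [show (fun p => p ^ (h * ℓ p)) = fun p => (p ^ ℓ p) ^ h by funext p; rw [mul_comm, pow_mul],
      Finset.prod_pow]
    congr 1
    have := Nat.prod_factorization_pow_eq_self hq0
    rw [Finsupp.prod, Nat.support_factorization] at this
    exact this
  -- coordinates are in `(0, q^h)`
  have hxlt : ∀ x ∈ S, ∀ i, 0 < x i ∧ x i < (q : ℤ) ^ h := by
    intro x hx i
    obtain ⟨h1, h2⟩ := hSB x hx i
    refine ⟨by omega, ?_⟩
    have : (x i : ℝ) < (q : ℝ) ^ h := lt_of_le_of_lt h2 hPq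
    exact_mod_cast this
  -- the reduction maps
  set red : ℕ → (Fin t → ℤ) → (Fin t → ℤ) := fun p x i => x i % (Np p : ℤ) with hred
  -- Step A: injectivity of `x ↦ (red p x)_p`
  have hinj : Set.InjOn (fun x => fun p : q.primeFactors => red p.1 x) S := by
    intro x hx x' hx' hxx'
    funext i
    have hdiff : ((q : ℤ) ^ h) ∣ x i - x' i := by
      rw [← Nat.cast_pow, ← hprodNp, Nat.cast_prod]
      refine Finset.prod_dvd_of_coprime ?_ fun p hp => ?_
      · intro p hp p' hp' hne
        have hpp := Nat.prime_of_mem_primeFactors (Finset.mem_coe.1 hp)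
        have hpp' := Nat.prime_of_mem_primeFactors (Finset.mem_coe.1 hp')
        simp only [Function.onFun, hNp]
        exact Int.isCoprime_iff_gcd_eq_one.2 (by
          rw [Int.gcd_natCast_natCast]
          exact (Nat.coprime_pow_primes _ _ hpp hpp' hne))
      · have := congr_fun (congr_fun hxx' ⟨p, hp⟩) i
        simp only [hred] at this
        have e : x i - x' i = (x i - x i % (Np p : ℤ)) - (x' i - x' i % (Np p : ℤ)) := by
          rw [this]; ring
        rw [e]
        exact dvd_sub Int.dvd_self_sub_emod Int.dvd_self_sub_emod
    obtain ⟨h1, h2⟩ := hxlt x hx i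
    obtain ⟨h3, h4⟩ := hxlt x' hx' i
    refine sub_eq_zero.1 (Int.eq_zero_of_abs_lt_dvd hdiff ?_)
    rw [abs_lt]; constructor <;> linarith
  -- Step B: the per-prime bound by Wooley
  have hper : ∀ p ∈ q.primeFactors, (S.image (red p)).card ≤ k ^ t := by
    intro p hp
    have hpp := Nat.prime_of_mem_primeFactors hp
    haveI : Fact p.Prime := ⟨hpp⟩
    have hℓ1 : 1 ≤ ℓ p := by
      rw [hℓ]; exact Nat.Prime.factorization_pos_of_dvd hpp hq0 (Nat.dvd_of_mem_primeFactors hp)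
    have hs1 : 1 ≤ h * ℓ p := one_le_mul hh hℓ1
    have hjlt : ∀ j : Fin t, h + j.val - 1 < k := fun j => by have := j.2; omega
    set c' : Fin t → ℤ := fun j => c ⟨h + j.val - 1, hjlt j⟩ with hc'
    have hW := Wooley.card_solutions_le (p := p) (merged h (fun _ : Fin t => (1 : ℤ)) c') hs1
      (S.image (red p)) ?_ ?_ ?_
    · refine hW.trans ?_
      calc ∏ j : Fin t, (merged h (fun _ => (1 : ℤ)) c' j).totalDegree ≤ ∏ _j : Fin t, k :=
            Finset.prod_le_prod' fun j _ => (totalDegree_merged_le h _ c' j).trans (by have := j.2; omega)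
        _ = k ^ t := by simp
    · -- solutions mod `p^{hℓ}`
      intro v hv j
      rw [mem_image] at hv
      obtain ⟨x, hx, rfl⟩ := hv
      rw [eval_merged]
      haveI : NeZero (p ^ (h * ℓ p)) := ⟨pow_ne_zero _ hpp.ne_zero⟩
      rw [← Nat.cast_pow, ← ZMod.intCast_zmod_eq_zero_iff_dvd]
      push_cast
      have hv : ∀ i, ((x i % (Np p : ℤ) : ℤ) : ZMod (p ^ (h * ℓ p))) = (x i : ZMod (p ^ (h * ℓ p))) := by
        intro i; rw [hNp]; simp only [Nat.cast_pow]; rw [← Nat.cast_pow, ZMod.intCast_mod]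
      simp only [hred, one_mul, hv]
      have hc := hcong x hx ⟨h + j.val - 1, hjlt j⟩ (by simp; omega)
      have hpsv : psv k x ⟨h + j.val - 1, hjlt j⟩ = ∑ i, x i ^ (h + j.val) := by
        simp only [psv]; exact sum_congr rfl fun i _ => by congr 1; omega
      have hdvd : ((p ^ (h * ℓ p) : ℕ) : ℤ) ∣ ∑ i, x i ^ (h + j.val) - c' j := by
        have := (hNp_dvd p hp).trans hc; rwa [hpsv] at this
      rw [← ZMod.intCast_zmod_eq_zero_iff_dvd] at hdvd
      push_cast at hdvd
      exact hdvd
    · -- non-singular Jacobian mod `p`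
      intro v hv
      rw [mem_image] at hv
      obtain ⟨x, hx, rfl⟩ := hv
      rw [eval_det_jacPoly_merged hh]
      intro hd
      haveI : NeZero p := ⟨hpp.ne_zero⟩
      have hformula := not_dvd_jac_formula (t := t) (h := h) hpp (hqk p hp) hh hk
        (x := x) (by
          have := (Nat.Prime.coprime_iff_not_dvd hpp).1
            ((hcop x hx).coprime_dvd_left (Nat.dvd_of_mem_primeFactors hp))
          exact this)
      apply hformula
      -- transfer the divisibility from `red p x` to `x` through `ZMod p`
      rw [← ZMod.intCast_zmod_eq_zero_iff_dvd] at hd ⊢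
      have hv : ∀ i, ((red p x i : ℤ) : ZMod p) = (x i : ZMod p) := fun i => by
        simp only [hred, hNp]
        exact zmod_cast_emod_of_dvd (dvd_pow_self p (by omega)) (x i)
      push_cast [Matrix.det_vandermonde] at hd ⊢
      simp only [hv] at hd
      exact hd
    · -- incongruent mod `p^{hℓ}`
      intro v hv w hw hvw
      rw [mem_image] at hv hw
      obtain ⟨x, -, rfl⟩ := hv
      obtain ⟨x', -, rfl⟩ := hw
      funext i
      have hd := hvw i
      simp only [hred, hNp] at hd ⊢
      have hN0 : (0 : ℤ) < ((p ^ (h * ℓ p) : ℕ) : ℤ) := by exact_mod_cast hNp_pos p hp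
      have h1 := Int.emod_nonneg (x i) hN0.ne'
      have h2 := Int.emod_lt_of_pos (x i) hN0
      have h3 := Int.emod_nonneg (x' i) hN0.ne'
      have h4 := Int.emod_lt_of_pos (x' i) hN0
      push_cast at hd h1 h2 h3 h4 ⊢
      refine sub_eq_zero.1 (Int.eq_zero_of_abs_lt_dvd hd ?_)
      rw [abs_lt]; constructor <;> linarith
  -- Step C: multiply
  calc S.card = (S.image fun x => fun p : q.primeFactors => red p.1 x).card := (card_image_of_injOn hinj).symm
    _ ≤ (Fintype.piFinset fun p : q.primeFactors => S.image (red p.1)).card := by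
        refine card_le_card fun v hv => ?_
        rw [mem_image] at hv
        obtain ⟨x, hx, rfl⟩ := hv
        rw [Fintype.mem_piFinset]
        exact fun p => mem_image_of_mem _ hx
    _ = ∏ p : q.primeFactors, (S.image (red p.1)).card := Fintype.card_piFinset _
    _ ≤ ∏ _p : q.primeFactors, k ^ t := Finset.prod_le_prod' fun p _ => hper p.1 p.2
    _ = (k ^ t) ^ q.primeFactors.card := by simp

end Cong

end FordVK
end Literature.NumberTheory.LFunctions
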